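import Summits.QuantumFields.YangMills.Theorems.FluctuationComparisonRegPrIntLS2BetaSlowDataNets
import Summits.QuantumFields.YangMills.Theorems.FluctuationComparisonRegPrIntLS2BetaAntipodalConeCentre
import Summits.QuantumFields.YangMills.Theorems.FluctuationComparisonRegPrIntLS2BetaCubeOffsetAlgebra
import HarnessLib

/-!
# S2β · D-GUARD ∕ (BG∞) — (B3-S) A CONE CENTRE FOR A SLOW SHELL: data on the boundary shell of `{0..n}³` with per-bond oscillation `dist1 ≤ δ` along the three
# families of forward shell steps, subsampled every `m` steps on each of the six faces (px5 g24's ✓p840086 nets), admit a centre `a` with every shell datum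
# inside the cap `‖logVec (a⁻¹·ψ)‖ ≤ π − r` once `(π∕2)·2(m−1)·δ ≤ r∕2` and `6(n∕m+1)²·(2∕(3π))(3r∕2)³ < 1` (px19 g25's ✓p839220 antipodal centre) — the
# shell-cap hypothesis of S2 ✓p839993 `exists_coneOnCube` ∕ (L-S) `hcap`, also read in the OFFSET-VECTOR currency of (L-S) (px5's (B3) ring edition ONE DIMENSION UP)

Cell `ym3-torus` (YM ladder rung R3 = continuum `SU(2)` Yang–Mills on the three-torus at fixed lattice data — a RUNG: NOT d = 4, NOT infinite volume,
NOT a mass gap, NOT Clay).  Width seat «width 8» `ym3-torus-px8` (gen 28, toron∕flux lineage ✓p826411 → px17 (W1) ✓p837971), FREE px helper on crux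
`stmt-QuantumFields-20520`; `--kind proof --supports stmt-QuantumFields-20520 --as helper`, count-neutral, DEFINITION-FREE (0 `def`, 0 `instance`, 0 `notation`,
0 `sorry`, default heartbeats).  NAMED by px5 g24 (STATUS 2026-09-01T02:24:57Z (B3) «px8 g28 ‼ shell twin … yours with (L-S) or mine next — say which»; mine,
02:25:24Z) with px19 g25's word 02:28:37Z «the SHELL twin for stage 3 — px8's call … either is fine for (L-Σ)»; cubic edition per LEAD RULING №67 route (SQ)
(every stage-3 block is a cube `c₀³`).

WHY.  The stage-S cone (S2 ✓p839993, read on a block by (L-S) ✓p840187 + `…SqrtGaugeStageSBlock`) needs a centre `a` with ALL shell data of the cube inside the cap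
`π − r`, and its step constants carry `Λ = (π − r)∕sin r`; for an ABSOLUTE `Λ` the radius `r` must not depend on the block side.  ✓`exists_coneCentre_of_patched`
delivers `a` from a NET of absolute cardinality whose `r∕2`-patches cover the data; the six faces of the shell are `(n+1)²` grids with per-bond oscillation `δ`, and
✓`exists_patch_of_grid` subsamples each every `m ∝ n` steps into `(n∕m+1)²` net points with patch radius `(π∕2)·2(m−1)·δ` — THIS FILE assembles the six nets and reads
the conclusion on the shell, then once more through the cube of an offset vector `t` so that (L-Σ) obtains (L-S)'s `hcap` from (L-S)'s own `hstep` letters.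

WHAT IS PROVED (sorry-free; def-free).
* §1 `card_faces` (`card (((F ⊕ F) ⊕ (F ⊕ F)) ⊕ (F ⊕ F)) = 6·(A·A)`, `F := Fin A × Fin A`), ★★★ `exists_shellCentre (n m) (hm : 1 ≤ m) (ψ : ℕ × ℕ × ℕ → SU2) (hδ hr0 hrπ)
  (h1 h2 h3 : the three forward shell-step letters ≤ δ — the SAME letters as ✓`…CubeOffsetAlgebra.shellAdj_of_steps`) (hrad : π∕2·(2(m−1)·δ) ≤ r∕2)
  (hcard : 6(n∕m+1)²·(2∕(3π))(3r∕2)³ < 1) : ∃ a, ∀ i k l ≤ n, shell → ‖logVec (su2Quat (a⁻¹ * ψ (i, k, l)))‖ ≤ π − r` — conclusion = the shell-cap hypothesis of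
  ✓`exists_coneOnCube` VERBATIM.
* §2 `eq_uuu_of_mem_cube` (an offset vector in the cube of `t` IS the cube point of its three coordinates), ★★★ `exists_cubeCentre (φ) (hαβ hαγ hβγ) (t) (n m) …
  (hstep : (L-S)'s per-bond shell letter in offset-vector currency, with `δ`) (hrad) (hcard) : ∃ a, ∀ u, update³ u = t → u α ≤ n → u β ≤ n → u γ ≤ n → shell →
  ‖logVec (su2Quat (a⁻¹ * φ u))‖ ≤ π − r` — conclusion = (L-S)'s `hcap` VERBATIM (so the assembler writes `obtain ⟨a, hcap⟩ := exists_cubeCentre …` then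
  `obtain ⟨Wc, hWc⟩ := exists_coneOnCube n hn hr hrπ a`).

HONEST SCOPE.  Composition of landed metric bookkeeping (✓p840086, ✓p839220) with offset algebra (✓p840187); the two numeric side conditions are the CONSUMER's
(§116.3's `r_S`, `m ∝ ρ` enter there once; no number is fixed here); no gauge field; nothing of Bałaban's renormalisation-group analysis is asserted or proved
([Balaban1985RegularSpaces] Thm 2 p.83 — local small gauges — is the consumer's context only).  `hSec`∕`hSec₂` ∕ (BG∞) ∕ `hBG` are CONJECTURES (plan §116) and NOT
proved; GAP♯∘ (`stub_uniformFibreGapOrbit`; registry v11 UNTOUCHED), the five registered stubs (0∕5), S2β, 20520, 19936, 19200, `YM3TorusSU2` are NOT proved; no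
registered stub is closed; rung R3 — NOT d = 4, NOT infinite volume, NOT a mass gap, NOT Clay; the Yang–Mills mass gap is NOT proved.  Axioms standard.

References: T. Bałaban, CMP **99** (1985) 75–102 [Balaban1985RegularSpaces] (Thm 2 p.83).
-/

set_option autoImplicit false

noncomputable section

namespace Summit.QuantumFields.YangMills.Theorems.FluctuationComparisonRegPrIntLS2BetaSlowShellConeCentre

open scoped Real
open Literature.MathematicalPhysics.QuantumLattice (su2Quat)
open Literature.MathematicalPhysics.QuantumFieldTheory.Balaban1983to89
open T4CubeChartGnomonic (SU2)
open T4ExpWindowSmallField (logVec)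
open Summit.QuantumFields.YangMills.Theorems.FluctuationComparisonRegPrIntLS2BetaSlowDataNets (exists_patch_of_grid)
open Summit.QuantumFields.YangMills.Theorems.FluctuationComparisonRegPrIntLS2BetaAntipodalConeCentre (exists_coneCentre_of_patched)
open Summit.QuantumFields.YangMills.Theorems.FluctuationComparisonRegPrIntLS2BetaCubeOffsetAlgebra

/-! ## §1 The centre of a slow shell -/

/-- The cardinality of the six-faces index type over `F := Fin A × Fin A`: `6·(A·A)`. [folklore] -/
theorem card_faces (A : ℕ) :
    (Fintype.card ((((Fin A × Fin A) ⊕ (Fin A × Fin A)) ⊕ ((Fin A × Fin A) ⊕ (Fin A × Fin A))) ⊕ ((Fin A × Fin A) ⊕ (Fin A × Fin A))) : ℝ) =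
      ((6 * (A * A) : ℕ) : ℝ) := by
  have h : Fintype.card ((((Fin A × Fin A) ⊕ (Fin A × Fin A)) ⊕ ((Fin A × Fin A) ⊕ (Fin A × Fin A))) ⊕ ((Fin A × Fin A) ⊕ (Fin A × Fin A))) =
      6 * (A * A) := by
    simp only [Fintype.card_sum, Fintype.card_prod, Fintype.card_fin]; ring
  rw [h]

/-- ★★★ **A CONE CENTRE FOR A SLOW SHELL**: data `ψ` on the boundary shell of `{0..n}³` with per-bond oscillation `dist1 ≤ δ` along the three families of forward
shell steps (the letters of ✓`…CubeOffsetAlgebra.shellAdj_of_steps`), a subsampling step `m ≥ 1` with `(π∕2)·2(m−1)·δ ≤ r∕2`, and the packing count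
`6(n∕m+1)²·(2∕(3π))(3r∕2)³ < 1` admit a centre `a` with every shell datum inside the cap `‖logVec (a⁻¹·ψ (i,k,l))‖ ≤ π − r` — the shell-cap hypothesis of
✓`exists_coneOnCube` ∕ (L-S). [cite: Balaban1985RegularSpaces, Thm 2 p.83] -/
theorem exists_shellCentre (n m : ℕ) (hm : 1 ≤ m) (ψ : ℕ × ℕ × ℕ → SU2) {δ r : ℝ} (hδ : 0 ≤ δ) (hr0 : 0 ≤ r) (hrπ : 3 * r / 2 ≤ π)
    (h1 : ∀ i k l, i + 1 ≤ n → k ≤ n → l ≤ n → (i = 0 ∨ i = n ∨ k = 0 ∨ k = n ∨ l = 0 ∨ l = n) →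
      (i + 1 = n ∨ k = 0 ∨ k = n ∨ l = 0 ∨ l = n) → dist1 (ψ (i, k, l) * (ψ (i + 1, k, l))⁻¹) ≤ δ)
    (h2 : ∀ i k l, i ≤ n → k + 1 ≤ n → l ≤ n → (i = 0 ∨ i = n ∨ k = 0 ∨ k = n ∨ l = 0 ∨ l = n) →
      (i = 0 ∨ i = n ∨ k + 1 = n ∨ l = 0 ∨ l = n) → dist1 (ψ (i, k, l) * (ψ (i, k + 1, l))⁻¹) ≤ δ)
    (h3 : ∀ i k l, i ≤ n → k ≤ n → l + 1 ≤ n → (i = 0 ∨ i = n ∨ k = 0 ∨ k = n ∨ l = 0 ∨ l = n) →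
      (i = 0 ∨ i = n ∨ k = 0 ∨ k = n ∨ l + 1 = n) → dist1 (ψ (i, k, l) * (ψ (i, k, l + 1))⁻¹) ≤ δ)
    (hrad : π / 2 * (((2 * (m - 1) : ℕ) : ℝ) * δ) ≤ r / 2)
    (hcard : ((6 * ((n / m + 1) * (n / m + 1)) : ℕ) : ℝ) * (2 / (3 * π) * (3 * r / 2) ^ 3) < 1) :
    ∃ a : SU2, ∀ i k l, i ≤ n → k ≤ n → l ≤ n → (i = 0 ∨ i = n ∨ k = 0 ∨ k = n ∨ l = 0 ∨ l = n) →
      ‖logVec (su2Quat (a⁻¹ * ψ (i, k, l)))‖ ≤ π - r := by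
  -- the six faces as slow grids, subsampled every `m` steps in both directions
  have hF1 := exists_patch_of_grid (fun k l => ψ (0, k, l)) n n hδ
    (fun k l hk hl => h2 0 k l (Nat.zero_le _) hk hl (Or.inl rfl) (Or.inl rfl))
    (fun k l hk hl => h3 0 k l (Nat.zero_le _) hk hl (Or.inl rfl) (Or.inl rfl)) m hm
  have hF2 := exists_patch_of_grid (fun k l => ψ (n, k, l)) n n hδ
    (fun k l hk hl => h2 n k l le_rfl hk hl (Or.inr (Or.inl rfl)) (Or.inr (Or.inl rfl)))
    (fun k l hk hl => h3 n k l le_rfl hk hl (Or.inr (Or.inl rfl)) (Or.inr (Or.inl rfl))) m hm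
  have hF3 := exists_patch_of_grid (fun i l => ψ (i, 0, l)) n n hδ
    (fun i l hi hl => h1 i 0 l hi (Nat.zero_le _) hl (Or.inr (Or.inr (Or.inl rfl))) (Or.inr (Or.inl rfl)))
    (fun i l hi hl => h3 i 0 l hi (Nat.zero_le _) hl (Or.inr (Or.inr (Or.inl rfl))) (Or.inr (Or.inr (Or.inl rfl)))) m hm
  have hF4 := exists_patch_of_grid (fun i l => ψ (i, n, l)) n n hδ
    (fun i l hi hl => h1 i n l hi le_rfl hl (Or.inr (Or.inr (Or.inr (Or.inl rfl)))) (Or.inr (Or.inr (Or.inl rfl))))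
    (fun i l hi hl => h3 i n l hi le_rfl hl (Or.inr (Or.inr (Or.inr (Or.inl rfl)))) (Or.inr (Or.inr (Or.inr (Or.inl rfl))))) m hm
  have hF5 := exists_patch_of_grid (fun i k => ψ (i, k, 0)) n n hδ
    (fun i k hi hk => h1 i k 0 hi hk (Nat.zero_le _) (Or.inr (Or.inr (Or.inr (Or.inr (Or.inl rfl))))) (Or.inr (Or.inr (Or.inr (Or.inl rfl)))))
    (fun i k hi hk => h2 i k 0 hi hk (Nat.zero_le _) (Or.inr (Or.inr (Or.inr (Or.inr (Or.inl rfl))))) (Or.inr (Or.inr (Or.inr (Or.inl rfl))))) m hm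
  have hF6 := exists_patch_of_grid (fun i k => ψ (i, k, n)) n n hδ
    (fun i k hi hk => h1 i k n hi hk le_rfl (Or.inr (Or.inr (Or.inr (Or.inr (Or.inr rfl))))) (Or.inr (Or.inr (Or.inr (Or.inr rfl)))))
    (fun i k hi hk => h2 i k n hi hk le_rfl (Or.inr (Or.inr (Or.inr (Or.inr (Or.inr rfl))))) (Or.inr (Or.inr (Or.inr (Or.inr rfl))))) m hm
  obtain ⟨a, ha⟩ := exists_coneCentre_of_patched
    (ι := (((Fin (n / m + 1) × Fin (n / m + 1)) ⊕ (Fin (n / m + 1) × Fin (n / m + 1))) ⊕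
      ((Fin (n / m + 1) × Fin (n / m + 1)) ⊕ (Fin (n / m + 1) × Fin (n / m + 1)))) ⊕
      ((Fin (n / m + 1) × Fin (n / m + 1)) ⊕ (Fin (n / m + 1) × Fin (n / m + 1))))
    (Sum.elim
      (Sum.elim
        (Sum.elim (fun q => ψ (0, m * (q.1 : ℕ), m * (q.2 : ℕ))) (fun q => ψ (n, m * (q.1 : ℕ), m * (q.2 : ℕ))))
        (Sum.elim (fun q => ψ (m * (q.1 : ℕ), 0, m * (q.2 : ℕ))) (fun q => ψ (m * (q.1 : ℕ), n, m * (q.2 : ℕ)))))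
      (Sum.elim (fun q => ψ (m * (q.1 : ℕ), m * (q.2 : ℕ), 0)) (fun q => ψ (m * (q.1 : ℕ), m * (q.2 : ℕ), n))))
    (Sum.elim
      (Sum.elim
        (Sum.elim (fun p : Fin (n + 1) × Fin (n + 1) => ψ (0, (p.1 : ℕ), (p.2 : ℕ)))
          (fun p : Fin (n + 1) × Fin (n + 1) => ψ (n, (p.1 : ℕ), (p.2 : ℕ))))
        (Sum.elim (fun p : Fin (n + 1) × Fin (n + 1) => ψ ((p.1 : ℕ), 0, (p.2 : ℕ)))
          (fun p : Fin (n + 1) × Fin (n + 1) => ψ ((p.1 : ℕ), n, (p.2 : ℕ)))))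
      (Sum.elim (fun p : Fin (n + 1) × Fin (n + 1) => ψ ((p.1 : ℕ), (p.2 : ℕ), 0))
        (fun p : Fin (n + 1) × Fin (n + 1) => ψ ((p.1 : ℕ), (p.2 : ℕ), n))))
    hr0 hrπ
    (by
      -- every face datum is within `r∕2` of its subsample point
      rintro (((p | p) | (p | p)) | (p | p))
      · obtain ⟨q, hq⟩ := hF1 p
        exact ⟨Sum.inl (Sum.inl (Sum.inl q)), by simpa using hq.trans hrad⟩
      · obtain ⟨q, hq⟩ := hF2 p
        exact ⟨Sum.inl (Sum.inl (Sum.inr q)), by simpa using hq.trans hrad⟩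
      · obtain ⟨q, hq⟩ := hF3 p
        exact ⟨Sum.inl (Sum.inr (Sum.inl q)), by simpa using hq.trans hrad⟩
      · obtain ⟨q, hq⟩ := hF4 p
        exact ⟨Sum.inl (Sum.inr (Sum.inr q)), by simpa using hq.trans hrad⟩
      · obtain ⟨q, hq⟩ := hF5 p
        exact ⟨Sum.inr (Sum.inl q), by simpa using hq.trans hrad⟩
      · obtain ⟨q, hq⟩ := hF6 p
        exact ⟨Sum.inr (Sum.inr q), by simpa using hq.trans hrad⟩)
    (by rw [card_faces]; exact hcard)
  refine ⟨a, fun i k l hi hk hl hb => ?_⟩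
  rcases hb with h | h | h | h | h | h
  · have ha1 := ha (Sum.inl (Sum.inl (Sum.inl (⟨k, Nat.lt_succ_of_le hk⟩, ⟨l, Nat.lt_succ_of_le hl⟩))))
    rw [h]; simpa using ha1
  · have ha1 := ha (Sum.inl (Sum.inl (Sum.inr (⟨k, Nat.lt_succ_of_le hk⟩, ⟨l, Nat.lt_succ_of_le hl⟩))))
    rw [h]; simpa using ha1
  · have ha1 := ha (Sum.inl (Sum.inr (Sum.inl (⟨i, Nat.lt_succ_of_le hi⟩, ⟨l, Nat.lt_succ_of_le hl⟩))))
    rw [h]; simpa using ha1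
  · have ha1 := ha (Sum.inl (Sum.inr (Sum.inr (⟨i, Nat.lt_succ_of_le hi⟩, ⟨l, Nat.lt_succ_of_le hl⟩))))
    rw [h]; simpa using ha1
  · have ha1 := ha (Sum.inr (Sum.inl (⟨i, Nat.lt_succ_of_le hi⟩, ⟨k, Nat.lt_succ_of_le hk⟩)))
    rw [h]; simpa using ha1
  · have ha1 := ha (Sum.inr (Sum.inr (⟨i, Nat.lt_succ_of_le hi⟩, ⟨k, Nat.lt_succ_of_le hk⟩)))
    rw [h]; simpa using ha1


/-! ## §2 The centre read through the cube of an offset vector ((L-S) currency) -/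

variable {P : Params}

/-- An offset vector `u` in the cube of `t` (`update³ u (t α) (t β) (t γ) = t`) IS the cube point `t|_{α↦u α, β↦u β, γ↦u γ}`. [folklore] -/
theorem eq_uuu_of_mem_cube {d : ℕ} (t u : Fin d → ℕ) (α β γ : Fin d)
    (hu : Function.update (Function.update (Function.update u α (t α)) β (t β)) γ (t γ) = t) :
    u = Function.update (Function.update (Function.update t α (u α)) β (u β)) γ (u γ) := by
  funext κ
  by_cases hκγ : κ = γ
  · subst hκγ; rw [Function.update_self]
  rw [Function.update_of_ne hκγ]
  by_cases hκβ : κ = β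
  · subst hκβ; rw [Function.update_self]
  rw [Function.update_of_ne hκβ]
  by_cases hκα : κ = α
  · subst hκα; rw [Function.update_self]
  rw [Function.update_of_ne hκα, ← hu, Function.update_of_ne hκγ, Function.update_of_ne hκβ, Function.update_of_ne hκα]

/-- ★★★ **A CONE CENTRE FOR THE CUBE OF AN OFFSET VECTOR** ((L-S) currency): for pairwise distinct axes `α, β, γ`, an offset vector `t`, a side `n`, a subsampling
step `m ≥ 1` and the two numeric side conditions, (L-S)'s per-bond shell letter `hstep` (with `δ`) yields a centre `a` satisfying (L-S)'s shell-cap hypothesis `hcap`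
VERBATIM. [cite: Balaban1985RegularSpaces, Thm 2 p.83] -/
theorem exists_cubeCentre (φ : (Fin P.d → ℕ) → SU2) {α β γ : Fin P.d} (hαβ : α ≠ β) (hαγ : α ≠ γ) (hβγ : β ≠ γ) (t : Fin P.d → ℕ)
    (n m : ℕ) (hm : 1 ≤ m) {δ r : ℝ} (hδ : 0 ≤ δ) (hr0 : 0 ≤ r) (hrπ : 3 * r / 2 ≤ π)
    (hstep : ∀ u : Fin P.d → ℕ, ∀ κ : Fin P.d, (κ = α ∨ κ = β ∨ κ = γ) →
      Function.update (Function.update (Function.update u α (t α)) β (t β)) γ (t γ) = t →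
      u α ≤ n → u β ≤ n → u γ ≤ n → (u α = 0 ∨ u α = n ∨ u β = 0 ∨ u β = n ∨ u γ = 0 ∨ u γ = n) →
      Function.update u κ (u κ + 1) α ≤ n → Function.update u κ (u κ + 1) β ≤ n → Function.update u κ (u κ + 1) γ ≤ n →
      (Function.update u κ (u κ + 1) α = 0 ∨ Function.update u κ (u κ + 1) α = n ∨
        Function.update u κ (u κ + 1) β = 0 ∨ Function.update u κ (u κ + 1) β = n ∨
        Function.update u κ (u κ + 1) γ = 0 ∨ Function.update u κ (u κ + 1) γ = n) →
      dist1 (φ u * (φ (Function.update u κ (u κ + 1)))⁻¹) ≤ δ)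
    (hrad : π / 2 * (((2 * (m - 1) : ℕ) : ℝ) * δ) ≤ r / 2)
    (hcard : ((6 * ((n / m + 1) * (n / m + 1)) : ℕ) : ℝ) * (2 / (3 * π) * (3 * r / 2) ^ 3) < 1) :
    ∃ a : SU2, ∀ u : Fin P.d → ℕ, Function.update (Function.update (Function.update u α (t α)) β (t β)) γ (t γ) = t →
      u α ≤ n → u β ≤ n → u γ ≤ n → (u α = 0 ∨ u α = n ∨ u β = 0 ∨ u β = n ∨ u γ = 0 ∨ u γ = n) →
      ‖logVec (su2Quat (a⁻¹ * φ u))‖ ≤ π - r := by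
  obtain ⟨a, ha⟩ := exists_shellCentre n m hm
    (fun p : ℕ × ℕ × ℕ => φ (Function.update (Function.update (Function.update t α p.1) β p.2.1) γ p.2.2)) hδ hr0 hrπ
    (fun i k l hi hk hl hb hb' => by
      have h := hstep (Function.update (Function.update (Function.update t α i) β k) γ l) α (Or.inl rfl) (uuu_mem_cube t hαβ hαγ hβγ i k l)
      rw [uuu_step_fst t hαβ hαγ, uuu_apply_fst t hαβ hαγ, uuu_apply_snd t α hβγ, uuu_apply_thd,
        uuu_apply_fst t hαβ hαγ, uuu_apply_snd t α hβγ, uuu_apply_thd] at h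
      exact h (by omega) hk hl hb hi hk hl (by omega))
    (fun i k l hi hk hl hb hb' => by
      have h := hstep (Function.update (Function.update (Function.update t α i) β k) γ l) β (Or.inr (Or.inl rfl))
        (uuu_mem_cube t hαβ hαγ hβγ i k l)
      rw [uuu_step_snd t α hβγ, uuu_apply_fst t hαβ hαγ, uuu_apply_snd t α hβγ, uuu_apply_thd,
        uuu_apply_fst t hαβ hαγ, uuu_apply_snd t α hβγ, uuu_apply_thd] at h
      exact h hi (by omega) hl hb hi hk hl (by omega))
    (fun i k l hi hk hl hb hb' => by
      have h := hstep (Function.update (Function.update (Function.update t α i) β k) γ l) γ (Or.inr (Or.inr rfl))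
        (uuu_mem_cube t hαβ hαγ hβγ i k l)
      rw [uuu_step_thd t α β γ, uuu_apply_fst t hαβ hαγ, uuu_apply_snd t α hβγ, uuu_apply_thd,
        uuu_apply_fst t hαβ hαγ, uuu_apply_snd t α hβγ, uuu_apply_thd] at h
      exact h hi hk (by omega) hb hi hk hl (by omega))
    hrad hcard
  refine ⟨a, fun u hu hα hβ hγ hb => ?_⟩
  have h := ha (u α) (u β) (u γ) hα hβ hγ hb
  rw [← eq_uuu_of_mem_cube t u α β γ hu] at h
  exact h

end Summit.QuantumFields.YangMills.Theorems.FluctuationComparisonRegPrIntLS2BetaSlowShellConeCentre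

end
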